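import Mathlib
import Literature.Probability.LatticeModels.SharpnessProofs
import HarnessLib

/-!
# The lattice double sum of a flat two-point function against a clustering kernel
# (support file for `StrongCouplingIRTrivial`)

Route `InfraredLiouville` of `YangMills`, support item `stmt-QuantumFields-9708`
(`Summit.QuantumFields.YangMills.Theses.InfraredLiouville.StrongCouplingIRTrivial`).

Pure finite-sum bookkeeping on `ℤᵈ` (`Site d`, sup norm `‖·‖`), no measure theory. The rescaled
lattice two-point function at spacing `a` is `c₀ c₁ a⁸ ∑ₓ ∑_y φ₀(x) φ₁(y) K(x, y)` with
`φᵢ(x) = gᵢ(a x)`; when `g₀ ⊗ g₁ ∈ ⁰𝒮` (flat at the diagonal), `|φ₀(x) φ₁(y)| ≤ Φ (a‖x − y‖)^{M+1}`,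
and when the lattice state clusters, `|K(x, y)| ≤ C e^{−m‖x−y‖}`. This file bounds the double sum:

* `sum_Icc_exp_neg_mul_abs_le` — `∑_{|t| ≤ T} e^{−c|t|} ≤ 2/(1 − e^{−c})` on `ℤ`, uniformly in `T`;
* `sum_box_prod_le_pow` — product structure of sums over the cube `box d T`;
* `pow_mul_exp_neg_le` — `r^{M+1} e^{−m r} ≤ (M+1)! (2/m)^{M+1} e^{−m r/2}`;
* `sum_box_weight_le` — `∑_{z ∈ box d T} ‖z‖^{M+1} e^{−m‖z‖} ≤ W d m M` uniformly in `T`;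
* `abs_sum_sum_le` — the double-sum bound
  `|∑ₓ∑_y φ₀ φ₁ K| ≤ #(box d N) · Φ a^{M+1} C · W` when `φ₀` is supported in `box d N`.

All constants are explicit (`weightConst`); no named facts.
-/

noncomputable section

open Finset Real
open scoped BigOperators
open Literature.Probability.LatticeModels

namespace Summit.QuantumFields.YangMills.Theorems.StrongCouplingIRTrivial

namespace LatticeSum

variable {d : ℕ}

/-! ### One-dimensional two-sided geometric sums -/

/-- `e^{-c |t|} = q^{|t|}` with `q = e^{-c}`. [folklore] -/
theorem exp_neg_mul_abs_eq_pow (c : ℝ) (t : ℤ) :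
    Real.exp (-(c * |(t : ℝ)|)) = Real.exp (-c) ^ t.natAbs := by
  rw [← Real.exp_nat_mul, Nat.cast_natAbs, Int.cast_abs]
  ring_nf

/-- **Two-sided geometric sum.** For `c > 0` and every `T`,
`∑_{t = -T}^{T} e^{-c|t|} ≤ 2 / (1 - e^{-c})`. [folklore] -/
theorem sum_Icc_exp_neg_mul_abs_le {c : ℝ} (hc : 0 < c) (T : ℕ) :
    ∑ t ∈ Finset.Icc (-(T : ℤ)) T, Real.exp (-(c * |(t : ℝ)|)) ≤ 2 / (1 - Real.exp (-c)) := by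
  set q : ℝ := Real.exp (-c) with hq
  have hq0 : 0 ≤ q := (Real.exp_pos _).le
  have hq1 : q < 1 := Real.exp_lt_one_iff.2 (by linarith)
  simp only [exp_neg_mul_abs_eq_pow, ← hq]
  -- cover `[-T, T]` by the images of `{0, …, T}` under `n ↦ n` and `n ↦ -n`
  set s₁ : Finset ℤ := (Finset.range (T + 1)).image fun n : ℕ => (n : ℤ) with hs₁
  set s₂ : Finset ℤ := (Finset.range (T + 1)).image fun n : ℕ => -(n : ℤ) with hs₂
  have hcover : Finset.Icc (-(T : ℤ)) T ⊆ s₁ ∪ s₂ := by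
    intro t ht
    rw [Finset.mem_Icc] at ht
    rw [Finset.mem_union]
    rcases le_or_gt 0 t with h0 | h0
    · left
      refine Finset.mem_image.2 ⟨t.toNat, Finset.mem_range.2 ?_, ?_⟩
      · omega
      · omega
    · right
      refine Finset.mem_image.2 ⟨(-t).toNat, Finset.mem_range.2 ?_, ?_⟩
      · omega
      · omega
  have hgeom : ∑ n ∈ Finset.range (T + 1), q ^ n ≤ (1 - q)⁻¹ := by
    rw [← tsum_geometric_of_lt_one hq0 hq1]
    exact (summable_geometric_of_lt_one hq0 hq1).sum_le_tsum _ fun i _ => pow_nonneg hq0 i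
  have h1 : ∑ t ∈ s₁, q ^ t.natAbs = ∑ n ∈ Finset.range (T + 1), q ^ n := by
    rw [hs₁, Finset.sum_image fun a _ b _ h => by exact_mod_cast h]
    simp
  have h2 : ∑ t ∈ s₂, q ^ t.natAbs = ∑ n ∈ Finset.range (T + 1), q ^ n := by
    rw [hs₂, Finset.sum_image fun a _ b _ h => by simpa using h]
    simp
  have hnn : ∀ t : ℤ, 0 ≤ q ^ t.natAbs := fun t => pow_nonneg hq0 _
  calc ∑ t ∈ Finset.Icc (-(T : ℤ)) T, q ^ t.natAbs
      ≤ ∑ t ∈ s₁ ∪ s₂, q ^ t.natAbs :=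
        Finset.sum_le_sum_of_subset_of_nonneg hcover fun t _ _ => hnn t
    _ ≤ ∑ t ∈ s₁, q ^ t.natAbs + ∑ t ∈ s₂, q ^ t.natAbs := by
        rw [← Finset.sum_union_inter]
        exact le_add_of_nonneg_right (Finset.sum_nonneg fun t _ => hnn t)
    _ ≤ (1 - q)⁻¹ + (1 - q)⁻¹ := by rw [h1, h2]; exact add_le_add hgeom hgeom
    _ = 2 / (1 - q) := by ring

/-! ### Sums over cubes of product weights -/

/-- **Product structure of the cube.** If `g ≥ 0` on `ℤ` has two-sided partial sums `≤ S`, then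
`∑_{z ∈ box d T} ∏ᵢ g(zᵢ) ≤ S^d`. [folklore] -/
theorem sum_box_prod_le_pow {g : ℤ → ℝ} (hg : ∀ t, 0 ≤ g t) {S : ℝ}
    (hS : ∀ T : ℕ, ∑ t ∈ Finset.Icc (-(T : ℤ)) T, g t ≤ S) (T : ℕ) :
    ∑ z ∈ box d T, ∏ i, g (z i) ≤ S ^ d := by
  have h : ∑ z ∈ box d T, ∏ i, g (z i) = ∏ _i : Fin d, ∑ t ∈ Finset.Icc (-(T : ℤ)) T, g t := by
    rw [Finset.prod_univ_sum]
    rfl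
  rw [h, Finset.prod_const, Finset.card_univ, Fintype.card_fin]
  exact pow_le_pow_left₀ (Finset.sum_nonneg fun t _ => hg t) (hS T) d

/-- Coordinates are bounded by the sup norm: `|zᵢ| ≤ ‖z‖`. [folklore] -/
theorem abs_cast_apply_le_norm (z : Site d) (i : Fin d) : |(z i : ℝ)| ≤ ‖z‖ := by
  have h := norm_le_pi_norm z i
  rwa [Int.norm_eq_abs] at h

/-- `e^{-c‖z‖} ≤ ∏ᵢ e^{-(c/d)|zᵢ|}` for `c ≥ 0` (since `∑ᵢ |zᵢ| ≤ d ‖z‖`). [folklore] -/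
theorem exp_neg_mul_norm_le_prod {c : ℝ} (hc : 0 ≤ c) (z : Site d) :
    Real.exp (-(c * ‖z‖)) ≤ ∏ i, Real.exp (-(c / d * |(z i : ℝ)|)) := by
  rcases Nat.eq_zero_or_pos d with rfl | hd
  · simp [Pi.norm_def]
  rw [← Real.exp_sum, Real.exp_le_exp]
  have hsum : ∑ i : Fin d, |(z i : ℝ)| ≤ d * ‖z‖ := by
    calc ∑ i : Fin d, |(z i : ℝ)| ≤ ∑ _i : Fin d, ‖z‖ :=
          Finset.sum_le_sum fun i _ => abs_cast_apply_le_norm z i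
      _ = d * ‖z‖ := by simp
  have hd' : (0 : ℝ) < d := by exact_mod_cast hd
  calc -(c * ‖z‖) = -(c / d * (d * ‖z‖)) := by field_simp
    _ ≤ -(c / d * ∑ i : Fin d, |(z i : ℝ)|) := by
        have := mul_le_mul_of_nonneg_left hsum (div_nonneg hc hd'.le)
        linarith
    _ = ∑ i : Fin d, -(c / d * |(z i : ℝ)|) := by
        rw [Finset.mul_sum, ← Finset.sum_neg_distrib]

/-- **Polynomial times exponential.** `r^{M+1} e^{-m r} ≤ (M+1)! (2/m)^{M+1} e^{-(m/2) r}` for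
`r ≥ 0`, `m > 0` (Mathlib `Real.pow_div_factorial_le_exp`). [folklore] -/
theorem pow_mul_exp_neg_le {m : ℝ} (hm : 0 < m) (M : ℕ) {r : ℝ} (hr : 0 ≤ r) :
    r ^ (M + 1) * Real.exp (-(m * r)) ≤
      ((M + 1).factorial : ℝ) * (2 / m) ^ (M + 1) * Real.exp (-(m / 2 * r)) := by
  have h := Real.pow_div_factorial_le_exp (m / 2 * r) (by positivity) (M + 1)
  rw [div_le_iff₀ (by positivity)] at h
  have hfac : (0 : ℝ) < ((M + 1).factorial : ℝ) := by positivity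
  -- `r^{M+1} = (2/m)^{M+1} (m/2 · r)^{M+1}`
  have hr' : r ^ (M + 1) = (2 / m) ^ (M + 1) * (m / 2 * r) ^ (M + 1) := by
    rw [← mul_pow]; congr 1; field_simp
  have hexp : Real.exp (-(m * r)) = Real.exp (-(m / 2 * r)) * Real.exp (-(m / 2 * r)) := by
    rw [← Real.exp_add]; congr 1; ring
  rw [hr', hexp]
  have h2 : (m / 2 * r) ^ (M + 1) * Real.exp (-(m / 2 * r)) ≤ ((M + 1).factorial : ℝ) := by
    calc (m / 2 * r) ^ (M + 1) * Real.exp (-(m / 2 * r))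
        ≤ Real.exp (m / 2 * r) * ((M + 1).factorial : ℝ) * Real.exp (-(m / 2 * r)) :=
          mul_le_mul_of_nonneg_right h (Real.exp_pos _).le
      _ = ((M + 1).factorial : ℝ) := by
          rw [mul_comm (Real.exp _), mul_assoc, ← Real.exp_add, add_neg_cancel, Real.exp_zero,
            mul_one]
  calc (2 / m) ^ (M + 1) * (m / 2 * r) ^ (M + 1) * (Real.exp (-(m / 2 * r)) * Real.exp (-(m / 2 * r)))
      = (2 / m) ^ (M + 1) * ((m / 2 * r) ^ (M + 1) * Real.exp (-(m / 2 * r))) *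
          Real.exp (-(m / 2 * r)) := by ring
    _ ≤ (2 / m) ^ (M + 1) * ((M + 1).factorial : ℝ) * Real.exp (-(m / 2 * r)) := by
        gcongr
    _ = _ := by ring

/-- The explicit constant `W(d, m, M) = (M+1)! (2/m)^{M+1} (2 / (1 - e^{-m/(2d)}))^d` bounding
`∑_{z ∈ box d T} ‖z‖^{M+1} e^{-m‖z‖}` uniformly in `T`. [folklore] -/
def weightConst (d : ℕ) (m : ℝ) (M : ℕ) : ℝ :=
  ((M + 1).factorial : ℝ) * (2 / m) ^ (M + 1) * (2 / (1 - Real.exp (-(m / 2 / d)))) ^ d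

/-- `0 ≤ W(d, m, M)` for `m > 0`, `d ≥ 1`. [folklore] -/
theorem weightConst_nonneg (hd : 0 < d) {m : ℝ} (hm : 0 < m) (M : ℕ) : 0 ≤ weightConst d m M := by
  unfold weightConst
  have hd' : (0 : ℝ) < d := by exact_mod_cast hd
  have h1 : Real.exp (-(m / 2 / d)) < 1 := Real.exp_lt_one_iff.2 (by
    have : 0 < m / 2 / d := by positivity
    linarith)
  have h2 : 0 < 1 - Real.exp (-(m / 2 / d)) := by linarith
  positivity

/-- **Weighted cube sums are bounded.** For `m > 0`, `d ≥ 1`, every `M` and every `T`,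
`∑_{z ∈ box d T} ‖z‖^{M+1} e^{-m‖z‖} ≤ W(d, m, M)`. [folklore] -/
theorem sum_box_weight_le (hd : 0 < d) {m : ℝ} (hm : 0 < m) (M T : ℕ) :
    ∑ z ∈ box d T, ‖z‖ ^ (M + 1) * Real.exp (-(m * ‖z‖)) ≤ weightConst d m M := by
  have hd' : (0 : ℝ) < d := by exact_mod_cast hd
  set c : ℝ := m / 2 / d with hcdef
  have hc : 0 < c := by positivity
  -- termwise: `‖z‖^{M+1} e^{-m‖z‖} ≤ (M+1)! (2/m)^{M+1} ∏ᵢ e^{-c |zᵢ|}`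
  have hterm : ∀ z : Site d, ‖z‖ ^ (M + 1) * Real.exp (-(m * ‖z‖)) ≤
      ((M + 1).factorial : ℝ) * (2 / m) ^ (M + 1) * ∏ i, Real.exp (-(c * |(z i : ℝ)|)) := by
    intro z
    refine (pow_mul_exp_neg_le hm M (norm_nonneg z)).trans ?_
    refine mul_le_mul_of_nonneg_left ?_ (by positivity)
    have h := exp_neg_mul_norm_le_prod (c := m / 2) (by positivity) z
    have hc' : m / 2 / d = c := rfl
    simpa only [hc'] using h
  have hS : ∀ T : ℕ, ∑ t ∈ Finset.Icc (-(T : ℤ)) T, Real.exp (-(c * |(t : ℝ)|)) ≤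
      2 / (1 - Real.exp (-c)) := sum_Icc_exp_neg_mul_abs_le hc
  calc ∑ z ∈ box d T, ‖z‖ ^ (M + 1) * Real.exp (-(m * ‖z‖))
      ≤ ∑ z ∈ box d T, ((M + 1).factorial : ℝ) * (2 / m) ^ (M + 1) *
          ∏ i, Real.exp (-(c * |(z i : ℝ)|)) := Finset.sum_le_sum fun z _ => hterm z
    _ = ((M + 1).factorial : ℝ) * (2 / m) ^ (M + 1) *
          ∑ z ∈ box d T, ∏ i, Real.exp (-(c * |(z i : ℝ)|)) := by rw [Finset.mul_sum]
    _ ≤ ((M + 1).factorial : ℝ) * (2 / m) ^ (M + 1) * (2 / (1 - Real.exp (-c))) ^ d := by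
        refine mul_le_mul_of_nonneg_left ?_ (by positivity)
        exact sum_box_prod_le_pow (fun t => (Real.exp_pos _).le) hS T
    _ = weightConst d m M := by rw [weightConst, hcdef]

/-- Shifted weights: for `x ∈ box d T`, `∑_{y ∈ box d T} ‖x − y‖^{M+1} e^{−m‖x−y‖} ≤ W(d, m, M)`
(reindex `z = x − y ∈ box d (2T)`). [folklore] -/
theorem sum_box_weight_sub_le (hd : 0 < d) {m : ℝ} (hm : 0 < m) (M T : ℕ) {x : Site d}
    (hx : x ∈ box d T) :
    ∑ y ∈ box d T, ‖x - y‖ ^ (M + 1) * Real.exp (-(m * ‖x - y‖)) ≤ weightConst d m M := by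
  set w : Site d → ℝ := fun z => ‖z‖ ^ (M + 1) * Real.exp (-(m * ‖z‖)) with hw
  have hw0 : ∀ z, 0 ≤ w z := fun z => by positivity
  have hinj : Set.InjOn (fun y : Site d => x - y) ↑(box d T) := fun a _ b _ h => by
    simpa using h
  have himg : (box d T).image (fun y => x - y) ⊆ box d (2 * T) := by
    intro z hz
    obtain ⟨y, hy, rfl⟩ := Finset.mem_image.1 hz
    rw [mem_box] at hx hy ⊢
    intro i
    have h1 := hx i
    have h2 := hy i
    simp only [Pi.sub_apply, Nat.cast_mul, Nat.cast_ofNat]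
    omega
  calc ∑ y ∈ box d T, ‖x - y‖ ^ (M + 1) * Real.exp (-(m * ‖x - y‖))
      = ∑ y ∈ box d T, w (x - y) := rfl
    _ = ∑ z ∈ (box d T).image (fun y => x - y), w z := (Finset.sum_image hinj).symm
    _ ≤ ∑ z ∈ box d (2 * T), w z :=
        Finset.sum_le_sum_of_subset_of_nonneg himg fun z _ _ => hw0 z
    _ ≤ weightConst d m M := sum_box_weight_le hd hm M (2 * T)

/-! ### The double sum -/

/-- **The double-sum bound.** On the cube `box d T`, let `|φ₀(x)| |φ₁(y)| ≤ Φ (a‖x−y‖)^{M+1}`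
(flatness of a `⁰𝒮` tensor at the diagonal), let `φ₀` be supported in `box d N`, and let the
kernel satisfy `|K(x,y)| ≤ C e^{−m‖x−y‖}` wherever `φ₀(x) φ₁(y) ≠ 0`. Then
`|∑ₓ ∑_y φ₀(x) φ₁(y) K(x,y)| ≤ #(box d N) · (Φ a^{M+1} C · W(d,m,M))`. [folklore] -/
theorem abs_sum_sum_le (hd : 0 < d) (T N : ℕ) (φ₀ φ₁ : Site d → ℝ) (K : Site d → Site d → ℝ)
    {a Φ C m : ℝ} {M : ℕ} (hm : 0 < m) (ha : 0 ≤ a) (hΦ : 0 ≤ Φ) (hC : 0 ≤ C)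
    (hflat : ∀ x y, |φ₀ x| * |φ₁ y| ≤ Φ * (a * ‖x - y‖) ^ (M + 1))
    (hsupp : ∀ x, φ₀ x ≠ 0 → x ∈ box d N)
    (hK : ∀ x y, φ₀ x ≠ 0 → φ₁ y ≠ 0 → |K x y| ≤ C * Real.exp (-(m * ‖x - y‖))) :
    |∑ x ∈ box d T, ∑ y ∈ box d T, φ₀ x * φ₁ y * K x y| ≤
      #(box d N) * (Φ * a ^ (M + 1) * C * weightConst d m M) := by
  classical
  set B : ℝ := Φ * a ^ (M + 1) * C * weightConst d m M with hB
  have hW := weightConst_nonneg hd hm M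
  have hB0 : 0 ≤ B := by positivity
  -- termwise bound
  have hterm : ∀ x y, |φ₀ x * φ₁ y * K x y| ≤
      Φ * a ^ (M + 1) * C * (‖x - y‖ ^ (M + 1) * Real.exp (-(m * ‖x - y‖))) := by
    intro x y
    by_cases h0 : φ₀ x = 0
    · rw [h0, zero_mul, zero_mul, abs_zero]; positivity
    by_cases h1 : φ₁ y = 0
    · rw [h1, mul_zero, zero_mul, abs_zero]; positivity
    rw [abs_mul, abs_mul]
    calc |φ₀ x| * |φ₁ y| * |K x y|
        ≤ Φ * (a * ‖x - y‖) ^ (M + 1) * (C * Real.exp (-(m * ‖x - y‖))) :=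
          mul_le_mul (hflat x y) (hK x y h0 h1) (abs_nonneg _) (by positivity)
      _ = _ := by ring
  -- inner sums
  have hinner : ∀ x ∈ box d T, ∑ y ∈ box d T, |φ₀ x * φ₁ y * K x y| ≤ B := by
    intro x hx
    calc ∑ y ∈ box d T, |φ₀ x * φ₁ y * K x y|
        ≤ ∑ y ∈ box d T, Φ * a ^ (M + 1) * C *
            (‖x - y‖ ^ (M + 1) * Real.exp (-(m * ‖x - y‖))) :=
          Finset.sum_le_sum fun y _ => hterm x y
      _ = Φ * a ^ (M + 1) * C *
            ∑ y ∈ box d T, ‖x - y‖ ^ (M + 1) * Real.exp (-(m * ‖x - y‖)) := by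
          rw [Finset.mul_sum]
      _ ≤ Φ * a ^ (M + 1) * C * weightConst d m M :=
          mul_le_mul_of_nonneg_left (sum_box_weight_sub_le hd hm M T hx) (by positivity)
  -- restrict the outer sum to the support of `φ₀`
  have hvanish : ∀ x ∈ box d T, ∑ y ∈ box d T, |φ₀ x * φ₁ y * K x y| ≠ 0 → φ₀ x ≠ 0 := by
    intro x _ hx h0
    apply hx
    simp [h0]
  calc |∑ x ∈ box d T, ∑ y ∈ box d T, φ₀ x * φ₁ y * K x y|
      ≤ ∑ x ∈ box d T, |∑ y ∈ box d T, φ₀ x * φ₁ y * K x y| := Finset.abs_sum_le_sum_abs _ _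
    _ ≤ ∑ x ∈ box d T, ∑ y ∈ box d T, |φ₀ x * φ₁ y * K x y| :=
        Finset.sum_le_sum fun x _ => Finset.abs_sum_le_sum_abs _ _
    _ = ∑ x ∈ (box d T).filter (fun x => φ₀ x ≠ 0), ∑ y ∈ box d T, |φ₀ x * φ₁ y * K x y| :=
        (Finset.sum_filter_of_ne hvanish).symm
    _ ≤ #((box d T).filter fun x => φ₀ x ≠ 0) • B :=
        Finset.sum_le_card_nsmul _ _ _ fun x hx => hinner x (Finset.mem_filter.1 hx).1
    _ = #((box d T).filter fun x => φ₀ x ≠ 0) * B := nsmul_eq_mul _ _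
    _ ≤ #(box d N) * B := by
        refine mul_le_mul_of_nonneg_right ?_ hB0
        exact_mod_cast Finset.card_le_card fun x hx => hsupp x (Finset.mem_filter.1 hx).2

end LatticeSum

end Summit.QuantumFields.YangMills.Theorems.StrongCouplingIRTrivial

end
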